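import Summits.Ventures.HSemireg.WedgeC15Laws
import Summits.Ventures.HSemireg.WedgeCarrierEcl

/-!
# Venture HSemireg — C15 on the contraction carrier (4/4): every coefficient sequence; the point pair by value

HONEST FRAMING. Part of the Lean index of the computation cell `pub-hsemireg` (seat p3; Sunday enclosure of the
FORMULA-N kernel assets of seats th-7 / th-6, ENCLOSURE-PLAN-p3.md).  Finite-dimensional exterior algebra over a field ONLY:
no variety, no cohomology theory, no semiregularity map is constructed here; nothing here says that HC / HC_CM / HC_AV holds;
no Literature fact is declared or used.  The geometric DICTIONARY (why these ranks are the `HT`-side box ranks of the cell's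
STRUCTURE.md §1 / theory/FORMULA-N.md) lives in theory/FORMULA-N-th7.md PART B §A.3 / §N and is NOT asserted in Lean.

th-7's ASSEMBLY, file 4 of 4 (theory/th7/WedgeC15.lean v1.4 sha256/16 45d63ee04200ecae (th-7 g3, 17:55Z; PART III = l.2277–2921), l.2806–2921, VERBATIM up to namespaces):
`Ψ_gw : Ψ(gw q k) = w_k(q)` (HankelRank's recursion verbatim after `y ↦ X`, `x ↦ Y`), **`finrank_S_Ecl_eq_hankel : dim S_k(Ecl q n) = C(n,k) · rank H_k(q)`**
for EVERY `q : ℕ → K` (no exponential-sum hypothesis; every field incl. finite, every n, k), **`finrank_contractionSpan_Ecl_eq_hankel`** (k = 2, the tree's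
`ContractionSpan.span` literally); and the POINT PAIR BY VALUE: `twoEnds`, **`hankel1_rank_twoEnded`** (the two-ended Hankel matrix `H_k(a,0,…,0,b)` has rank 2
for `0 < k < n`, `a b ≠ 0`: its only non-zero columns are `a·e_0` and `b·e_k`), **`finrank_S_pointPair_eq : dim S_k(a·1 + b·ω_V) = 2·C(n,k)`** (STRUCTURE P5's
`2·C(g,p)`, every field, every n).  This is THEOREM H (FORMULA-N PART A §2.6 / STRUCTURE C15) on the contraction carrier in full generality; the identification
of a geometric class with such a sequence is the remaining (geometric) input, not Lean.
-/

open Module Set Set.powersetCard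

namespace Summit.Ventures.HSemireg.WedgeC15

open Module Summit.Ventures.HSemireg.WedgeBridge Summit.Ventures.HSemireg.Wedge Summit.Ventures.HSemireg.Wedge.Hankel
open CliffordAlgebra (contractLeft)
open ExteriorAlgebra (ι)

variable {K : Type*} [Field K] {n : ℕ} {V : Type*} [AddCommGroup V] [Module K V] (bV : Basis (Fin (n + n)) K V)

/-- `Ψ(gw q k) = w_k(q)` — HankelRank's recursion verbatim after the relabelling. -/
theorem Ψ_gw : ∀ (k : ℕ) (q : ℕ → K), Ψ bV (gw bV q k) = w K n k q
  | 0, q => by rw [gw, w, AlgEquiv.commutes, Algebra.algebraMap_eq_smul_one]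
  | k + 1, q => by
    rw [gw, w, map_add, map_mul, map_mul, Ψ_gw k q, Ψ_gw k _, Ψ_YN, Ψ_XN]
    rfl

/-- **C15 ON THE CARRIER FOR EVERY COEFFICIENT SEQUENCE:** `dim S_k(Σ_m q_m E_m) = C(n,k) · rank H_k(q)` where
`E_m = Σ_{|S|=m} Π_{a∈S} ℓ_a ∧ m_a` (`= Θ^m/m!`), i.e. for EVERY class `v = v(q) ∈ K[Θ]` written in the divided-power basis —
no exponential-sum hypothesis, every field (also finite), every `n`, `k`. -/
theorem finrank_S_Ecl_eq_hankel (q : ℕ → K) (k : ℕ) :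
    Module.finrank K (WedgeBridge.S K (Lsp bV) k (Ecl bV q n)) = n.choose k * (hankel1 K n k q).rank := by
  rw [finrank_S_Ecl, finrank_range_wedge_eq, Ψ_gw, hankelLaw_model]

/-- the same in degree 2 for the TREE's `ContractionSpan.span` literally. -/
theorem finrank_contractionSpan_Ecl_eq_hankel (q : ℕ → K) :
    Module.finrank K (Summit.Ventures.HSemireg.ContractionSpan.span (Lsp bV : Set V)
        ((Lsp bV).dualAnnihilator : Set (Module.Dual K V)) (Ecl bV q n)) =
      n.choose 2 * (hankel1 K n 2 q).rank := by
  rw [← S_two_eq, finrank_S_Ecl_eq_hankel]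

/-! ### the two-ended Hankel matrix has rank 2, so the point pair has `dim S_k = 2·C(n,k)` for `0 < k < n` -/

/-- the two unit vectors `e_0, e_k` of `K^{k+1}` as a `Fin 2`-family. -/
def twoEnds (k : ℕ) : Fin 2 → Fin (k + 1) := fun j => if j = 0 then 0 else Fin.last k

/-- the two ends `0`, `last k` of `Fin (k+1)` are distinct for `0 < k`. -/
lemma twoEnds_injective {k : ℕ} (hk : 0 < k) : Function.Injective (twoEnds k) := by
  intro j j' h
  have h0 : (0 : Fin (k + 1)) ≠ Fin.last k := by
    intro h'
    have := congrArg Fin.val h'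
    simp only [Fin.val_zero, Fin.val_last] at this
    omega
  fin_cases j <;> fin_cases j' <;> simp_all [twoEnds]

/-- `twoEnds k 0 = 0`. -/
lemma twoEnds_zero (k : ℕ) : twoEnds k 0 = 0 := rfl
/-- `twoEnds k 1 = last k`. -/
lemma twoEnds_one (k : ℕ) : twoEnds k 1 = Fin.last k := rfl

/-- **rank of the two-ended Hankel matrix** `H_k(a, 0, …, 0, b) = 2` for `0 < k < n`, `a b ≠ 0`
(its only non-zero columns are `a·e_0` (first) and `b·e_k` (last)). -/
theorem hankel1_rank_twoEnded {a b : K} (ha : a ≠ 0) (hb : b ≠ 0) {k : ℕ} (hk : 0 < k) (hkn : k < n) :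
    (hankel1 K n k (fun m => (if m = 0 then a else 0) + (if m = n then b else 0))).rank = 2 := by
  classical
  set q : ℕ → K := fun m => (if m = 0 then a else 0) + (if m = n then b else 0) with hq
  set u : Fin 2 → (Fin (k + 1) → K) := fun j => Pi.basisFun K (Fin (k + 1)) (twoEnds k j) with hu
  have hli : LinearIndependent K u :=
    (Pi.basisFun K (Fin (k + 1))).linearIndependent.comp _ (twoEnds_injective hk)
  have hcard : Module.finrank K (Submodule.span K (Set.range u)) = 2 := by
    rw [finrank_span_eq_card hli, Fintype.card_fin]
  have hu0 : u 0 = Pi.single (0 : Fin (k + 1)) 1 := by rw [hu]; simp only [twoEnds_zero, Pi.basisFun_apply]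
  have hu1 : u 1 = Pi.single (Fin.last k) 1 := by rw [hu]; simp only [twoEnds_one, Pi.basisFun_apply]
  -- the columns
  have hcol0 : (hankel1 K n k q).col ⟨0, by omega⟩ = a • u 0 := by
    funext i
    have hi : (i : ℕ) ≠ n := by have := i.2; omega
    rw [hu0, Matrix.col_apply, hankel1, Matrix.of_apply, hq]
    simp only [add_zero, if_neg hi, Pi.smul_apply, Pi.single_apply, smul_eq_mul, mul_ite, mul_one, mul_zero,
      Fin.ext_iff, Fin.val_zero]
  have hcolL : (hankel1 K n k q).col ⟨n - k, by omega⟩ = b • u 1 := by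
    funext i
    have h1 : (i : ℕ) + (n - k) ≠ 0 := by omega
    have h2 : ((i : ℕ) + (n - k) = n) ↔ (i : ℕ) = k := by have := i.2; omega
    rw [hu1, Matrix.col_apply, hankel1, Matrix.of_apply, hq]
    simp only [if_neg h1, zero_add, h2, Pi.smul_apply, Pi.single_apply, smul_eq_mul, mul_ite, mul_one, mul_zero,
      Fin.ext_iff, Fin.val_last]
  have hcol_other : ∀ s : Fin (n + 1 - k), (s : ℕ) ≠ 0 → (s : ℕ) ≠ n - k → (hankel1 K n k q).col s = 0 := by
    intro s hs0 hsL
    funext i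
    have h1 : (i : ℕ) + (s : ℕ) ≠ 0 := by omega
    have h2 : (i : ℕ) + (s : ℕ) ≠ n := by have := i.2; have := s.2; omega
    rw [Matrix.col_apply, hankel1, Matrix.of_apply, hq]
    simp only [if_neg h1, if_neg h2, add_zero, Pi.zero_apply]
  have hspan : Submodule.span K (Set.range (hankel1 K n k q).col) = Submodule.span K (Set.range u) := by
    apply le_antisymm
    · apply Submodule.span_le.mpr
      rintro _ ⟨s, rfl⟩
      by_cases hs0 : (s : ℕ) = 0
      · have : s = ⟨0, by omega⟩ := Fin.ext hs0
        rw [this, hcol0]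
        exact Submodule.smul_mem _ _ (Submodule.subset_span ⟨0, rfl⟩)
      by_cases hsL : (s : ℕ) = n - k
      · have : s = ⟨n - k, by omega⟩ := Fin.ext hsL
        rw [this, hcolL]
        exact Submodule.smul_mem _ _ (Submodule.subset_span ⟨1, rfl⟩)
      · rw [hcol_other s hs0 hsL]
        exact Submodule.zero_mem _
    · apply Submodule.span_le.mpr
      rintro _ ⟨j, rfl⟩
      have hj : j = 0 ∨ j = 1 := by fin_cases j <;> simp
      rcases hj with rfl | rfl
      · have : u 0 = a⁻¹ • (hankel1 K n k q).col ⟨0, by omega⟩ := by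
          rw [hcol0, smul_smul, inv_mul_cancel₀ ha, one_smul]
        rw [this]
        exact Submodule.smul_mem _ _ (Submodule.subset_span ⟨_, rfl⟩)
      · have : u 1 = b⁻¹ • (hankel1 K n k q).col ⟨n - k, by omega⟩ := by
          rw [hcolL, smul_smul, inv_mul_cancel₀ hb, one_smul]
        rw [this]
        exact Submodule.smul_mem _ _ (Submodule.subset_span ⟨_, rfl⟩)
  rw [Matrix.rank_eq_finrank_span_cols, hspan, hcard]

/-- **THE POINT PAIR ON THE CARRIER, BY VALUE:** `dim S_k(a·1 + b·ω_V) = 2·C(n,k)` for `0 < k < n`, `a, b ≠ 0`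
(the closed form `2·C(g,p)` of STRUCTURE.md P5 / FORMULA-N §N.4, now on the contraction carrier). -/
theorem finrank_S_pointPair_eq {a b : K} (ha : a ≠ 0) (hb : b ≠ 0) {k : ℕ} (hk : 0 < k) (hkn : k < n) :
    Module.finrank K (WedgeBridge.S K (Lsp bV) k (algebraMap K _ a + b • (ellprod bV n * vacuum bV))) =
      2 * n.choose k := by
  rw [finrank_S_pointPair_eq_hankel, hankel1_rank_twoEnded ha hb hk hkn, mul_comm]

end Summit.Ventures.HSemireg.WedgeC15
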